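import Summits.Parity.GeneralizedHardyLittlewood.Theorems.ChenParityOracleBLAPHostParityFromBrickSwitchedBoxes
import HarnessLib

/-!
# Route `ChenParityOracleBLAP` — crux S1 = `HostParityFromBrick` (stmt-Parity-20045): the brick on a good class of the switched host

Support file for the switched half `K1 → K2 → HP2` of S1: the oracle congruence sums of ONE good
`ρ`-adic class `P₁(k) × P₂(i) × P₃(j)` of Chen triples, summed over all moduli `d ≤ x^{1/2−ε}`, are
at most `(1 + (1 + log x)²) · x/(log x)^A` under K1 and K2 at `x` (`sum_abs_product3_le`): the class
is a K-box (`sum_product3_eq_box`) inside the K-window (`class_window`), its coefficients are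
indicators of primes `≥ x^{1/8} ≥ w₀` and a fibre count `≤ 1` (unique factorisation,
`Chen.mul_injOn_primePairs`), so the brick-on-a-box inequality `brick_box_sum_le` applies.

References: Chen Jing-run, Sci. Sinica 16 (1973) [ChenSciSinica1973]; G. Harman, *Prime-Detecting
Sieves* (2007), Ch. 3 [Harman2007].
-/

namespace Summit.Parity.GeneralizedHardyLittlewood.Theorems

open Finset Real
open Literature.NumberTheory.Sieve.Chen

/-- **The brick on a good class.**  Under K1 and K2 at `x` (on the `δ`-window, saving `A`, level
`x^{1/2−ε}`; hypotheses `hK1`, `hK2` as in `brick_box_sum_le`), for `ρ ∈ (1, 6/5]` with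
`x + 2 ≤ ρ³x`, `w₀ ≤ ⌈x^{1/8}⌉`, `x^{1/3−δ} ≤ x^{1/3}/ρ − 1`, a good class `(k, i, j)` — `i < j`,
`8x^{1−δ} < ρ^{k+i+j+3} ≤ x + 2` — and sets `P₁ ⊆ {p prime : x^{1/8} ≤ p < y, ρ^k ≤ p < ρ^{k+1}}`,
`P₂ ⊆ {p prime : y ≤ p, ρ^i ≤ p < ρ^{i+1}}`, `P₃ ⊆ {p prime : y ≤ p, ρ^j ≤ p < ρ^{j+1}}`
(`y = ⌈(x+3)^{1/3}⌉`):
`∑_{d ≤ x^{1/2−ε}} |∑_{(p₁,p₂,p₃) ∈ P₁×P₂×P₃} [d ∣ p₁p₂p₃ − 2] λ(p₁p₂p₃ − 2)| ≤ (1 + (1 + log x)²) · x/(log x)^A`. -/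
theorem sum_abs_product3_le {x : ℕ} (hx24 : 24 ≤ x) {δ ε A : ℝ} (hε : 0 ≤ ε)
    (hw : 2 < Real.exp (Real.log x / Real.log (Real.log x)))
    (hK1 : ∀ M N : ℕ, (x : ℝ) ^ (1 / 3 - δ) ≤ M → (M : ℝ) ≤ (x : ℝ) ^ (1 / 2 : ℝ) →
      (x : ℝ) ^ (1 - δ) ≤ (M : ℝ) * N → (M : ℝ) * N ≤ x → ∀ α β : ℕ → ℝ, (∀ n, |α n| ≤ 1) →
      (∀ n, |β n| ≤ 1) →
      (∀ n, α n ≠ 0 → ∀ p ∈ n.primeFactors, Real.exp (Real.log x / Real.log (Real.log x)) ≤ p) →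
      (∀ n, β n ≠ 0 → ∀ p ∈ n.primeFactors, Real.exp (Real.log x / Real.log (Real.log x)) ≤ p) →
      ∀ h : ℤ, (h = 2 ∨ h = -2) →
      |∑ m ∈ Finset.Ioc M (2 * M), ∑ n ∈ Finset.Ioc N (2 * N),
        α m * β n * (ArithmeticFunction.liouville (Int.toNat ((m : ℤ) * n + h)) : ℝ)| ≤
        (x : ℝ) / Real.log x ^ A)
    (hK2 : ∀ M N : ℕ, (x : ℝ) ^ (1 / 3 - δ) ≤ M → (M : ℝ) ≤ (x : ℝ) ^ (1 / 2 : ℝ) →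
      (x : ℝ) ^ (1 - δ) ≤ (M : ℝ) * N → (M : ℝ) * N ≤ x → ∀ α β : ℕ → ℝ, (∀ n, |α n| ≤ 1) →
      (∀ n, |β n| ≤ 1) →
      (∀ n, α n ≠ 0 → ∀ p ∈ n.primeFactors, Real.exp (Real.log x / Real.log (Real.log x)) ≤ p) →
      (∀ n, β n ≠ 0 → ∀ p ∈ n.primeFactors, Real.exp (Real.log x / Real.log (Real.log x)) ≤ p) →
      ∀ h : ℤ, (h = 2 ∨ h = -2) →
      (∑ d ∈ (Finset.Icc 1 ⌊(x : ℝ) ^ (1 / 2 - ε)⌋₊).filter (fun d : ℕ => Odd d),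
        |(∑ m ∈ Finset.Ioc M (2 * M), ∑ n ∈ (Finset.Ioc N (2 * N)).filter
            (fun n : ℕ => (d : ℤ) ∣ (m : ℤ) * n + h),
            α m * β n * (ArithmeticFunction.liouville (Int.toNat ((m : ℤ) * n + h)) : ℝ)) -
          (Nat.totient d : ℝ)⁻¹ * ∑ m ∈ Finset.Ioc M (2 * M), ∑ n ∈ Finset.Ioc N (2 * N),
            α m * β n * (ArithmeticFunction.liouville (Int.toNat ((m : ℤ) * n + h)) : ℝ)|) ≤
        (x : ℝ) / Real.log x ^ A)
    {ρ : ℝ} (hρ : 1 < ρ) (hρ2 : ρ ≤ 6 / 5) (hρx : (x : ℝ) + 2 ≤ ρ ^ 3 * x)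
    (hw0z : Real.exp (Real.log x / Real.log (Real.log x)) ≤ twinZ x)
    (hxδ : (x : ℝ) ^ (1 / 3 - δ) ≤ (x : ℝ) ^ (1 / 3 : ℝ) / ρ - 1)
    {k i j : ℕ} (hij : i < j) (htop : ρ ^ (k + i + j + 3) ≤ (x : ℝ) + 2)
    (hbot : 8 * (x : ℝ) ^ (1 - δ) < ρ ^ (k + i + j + 3))
    {P₁ P₂ P₃ : Finset ℕ}
    (hP₁ : ∀ p ∈ P₁, p.Prime ∧ twinZ x ≤ p ∧ p < twinY x ∧ ρ ^ k ≤ (p : ℝ) ∧ (p : ℝ) < ρ ^ (k + 1))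
    (hP₂ : ∀ p ∈ P₂, p.Prime ∧ twinY x ≤ p ∧ ρ ^ i ≤ (p : ℝ) ∧ (p : ℝ) < ρ ^ (i + 1))
    (hP₃ : ∀ p ∈ P₃, p.Prime ∧ twinY x ≤ p ∧ ρ ^ j ≤ (p : ℝ) ∧ (p : ℝ) < ρ ^ (j + 1)) :
    ∑ d ∈ Finset.Icc 1 ⌊(x : ℝ) ^ (1 / 2 - ε)⌋₊,
      |∑ t ∈ P₁ ×ˢ (P₂ ×ˢ P₃), (if d ∣ t.1 * t.2.1 * t.2.2 - 2 then
          (ArithmeticFunction.liouville (t.1 * t.2.1 * t.2.2 - 2) : ℝ) else 0)| ≤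
      (1 + (1 + Real.log x) ^ 2) * ((x : ℝ) / Real.log x ^ A) := by
  classical
  set w := Real.exp (Real.log x / Real.log (Real.log x)) with hw_def
  set M : ℕ := ⌈ρ ^ i⌉₊ - 1 with hM
  set N : ℕ := ⌈ρ ^ (k + j)⌉₊ - 1 with hN
  have hx : 1 ≤ x := by omega
  have hx2 : 2 ≤ x := by omega
  have hx0 : (0 : ℝ) < x := by exact_mod_cast (show 0 < x by omega)
  have hB0 : 0 ≤ (1 + (1 + Real.log x) ^ 2) * ((x : ℝ) / Real.log x ^ A) := by
    have hl : 0 ≤ Real.log x := Real.log_nonneg (by exact_mod_cast hx)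
    positivity
  -- `y`, `z`
  have hz2 : 2 ≤ twinZ x := by
    have h1 : (1 : ℝ) < (x : ℝ) ^ (1 / 8 : ℝ) := Real.one_lt_rpow (by exact_mod_cast hx2) (by norm_num)
    have h2 : 1 < twinZ x := Nat.lt_ceil.mpr (by exact_mod_cast h1)
    omega
  have hzy : twinZ x ≤ twinY x := by
    unfold twinZ twinY
    refine Nat.ceil_mono ?_
    calc (x : ℝ) ^ (1 / 8 : ℝ) ≤ (x : ℝ) ^ (1 / 3 : ℝ) :=
          Real.rpow_le_rpow_of_exponent_le (by exact_mod_cast hx) (by norm_num)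
      _ ≤ ((x : ℝ) + 3) ^ (1 / 3 : ℝ) := Real.rpow_le_rpow (by positivity) (by linarith) (by norm_num)
  have hYx : (x : ℝ) ^ (1 / 3 : ℝ) < twinY x := by
    unfold twinY
    calc (x : ℝ) ^ (1 / 3 : ℝ) < ((x : ℝ) + 3) ^ (1 / 3 : ℝ) :=
          Real.rpow_lt_rpow (by positivity) (by linarith) (by norm_num)
      _ ≤ _ := Nat.le_ceil _
  have hY3 : (3 : ℝ) ≤ twinY x := by
    unfold twinY
    have h27 : (27 : ℝ) ≤ (x : ℝ) + 3 := by
      have : (24 : ℝ) ≤ x := by exact_mod_cast hx24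
      linarith
    have h3 : (3 : ℝ) = (27 : ℝ) ^ (1 / 3 : ℝ) := by
      rw [show (27 : ℝ) = 3 ^ (3 : ℝ) by norm_num, ← Real.rpow_mul (by norm_num)]
      norm_num
    calc (3 : ℝ) = (27 : ℝ) ^ (1 / 3 : ℝ) := h3
      _ ≤ ((x : ℝ) + 3) ^ (1 / 3 : ℝ) := Real.rpow_le_rpow (by norm_num) h27 (by norm_num)
      _ ≤ _ := Nat.le_ceil _
  -- the empty case
  by_cases hne : P₂.Nonempty ∧ (P₁ ×ˢ P₃).Nonempty
  swap
  · have h0 : P₁ ×ˢ (P₂ ×ˢ P₃) = ∅ := by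
      rw [not_and_or, Finset.not_nonempty_iff_eq_empty, Finset.not_nonempty_iff_eq_empty,
        Finset.product_eq_empty] at hne
      rcases hne with h | h | h
      · simp [h]
      · simp [h]
      · simp [h]
    rw [h0]
    simp only [Finset.sum_empty, abs_zero, Finset.sum_const_zero]
    exact hB0
  obtain ⟨⟨m₀, hm₀⟩, ⟨q₀, hq₀⟩⟩ := hne
  obtain ⟨-, hm₀y, hm₀i, hm₀i'⟩ := hP₂ m₀ hm₀
  rw [Finset.mem_product] at hq₀
  obtain ⟨-, hq₀z, -, -, hq₀k'⟩ := hP₁ q₀.1 hq₀.1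
  obtain ⟨-, hq₀y, hq₀j, hq₀j'⟩ := hP₃ q₀.2 hq₀.2
  -- the window
  have hz2' : (2 : ℝ) ≤ twinZ x := by exact_mod_cast hz2
  obtain ⟨hW1, hW2, hW3, hW4, hρi2, hρkj2⟩ := class_window hx2 hρ hρ2 hρx hxδ hY3 hYx hij htop hbot
    (by exact_mod_cast hm₀y) hm₀i hm₀i' (hz2'.trans (by exact_mod_cast hq₀z)) hq₀k'
    (hY3.trans (by exact_mod_cast hq₀y)) hq₀j hq₀j'
  -- sub-boxes
  have hS1 : P₂ ⊆ Finset.Ioc M (2 * M) := by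
    intro m hm
    obtain ⟨-, -, h1, h2⟩ := hP₂ m hm
    exact mem_Ioc_of_rho_interval hρ hρ2 (e := 1) (by norm_num) hρi2 h1 h2
  have hQmem : ∀ q ∈ P₁ ×ˢ P₃, q.1.Prime ∧ q.2.Prime ∧ twinZ x ≤ q.1 ∧ q.1 < twinY x ∧
      twinY x ≤ q.2 ∧ ρ ^ (k + j) ≤ ((q.1 * q.2 : ℕ) : ℝ) ∧ ((q.1 * q.2 : ℕ) : ℝ) < ρ ^ (k + j + 2) := by
    intro q hq
    rw [Finset.mem_product] at hq
    obtain ⟨hp1, hz1, hy1, hk1, hk1'⟩ := hP₁ q.1 hq.1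
    obtain ⟨hp3, hy3, hj3, hj3'⟩ := hP₃ q.2 hq.2
    refine ⟨hp1, hp3, hz1, hy1, hy3, ?_, ?_⟩
    · push_cast; rw [pow_add]
      exact mul_le_mul hk1 hj3 (by positivity) (Nat.cast_nonneg _)
    · push_cast
      calc (q.1 : ℝ) * q.2 < ρ ^ (k + 1) * ρ ^ (j + 1) :=
            mul_lt_mul'' hk1' hj3' (Nat.cast_nonneg _) (Nat.cast_nonneg _)
        _ = ρ ^ (k + j + 2) := by rw [← pow_add]; ring_nf
  have hS2 : ∀ q ∈ P₁ ×ˢ P₃, q.1 * q.2 ∈ Finset.Ioc N (2 * N) := by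
    intro q hq
    obtain ⟨-, -, -, -, -, h1, h2⟩ := hQmem q hq
    exact mem_Ioc_of_rho_interval hρ hρ2 (e := 2) le_rfl hρkj2 h1 h2
  have h2P₂ : ∀ m ∈ P₂, 2 ≤ m := fun m hm => (hP₂ m hm).1.two_le
  have h1Q : ∀ q ∈ P₁ ×ˢ P₃, 1 ≤ q.1 * q.2 := fun q hq =>
    Nat.one_le_iff_ne_zero.mpr (Nat.mul_ne_zero (hQmem q hq).1.ne_zero (hQmem q hq).2.1.ne_zero)
  -- the coefficients
  have hαb : ∀ n, |(if n ∈ P₂ then (1 : ℝ) else 0)| ≤ 1 := by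
    intro n; split_ifs <;> simp
  have hinj : Set.InjOn (fun q : ℕ × ℕ => q.1 * q.2) (P₁ ×ˢ P₃ : Finset (ℕ × ℕ)) :=
    mul_injOn_primePairs _ fun q hq => by
      obtain ⟨h1, h3, -, hy1, hy3, -, -⟩ := hQmem q hq
      exact ⟨h1, h3, by omega⟩
  have hβle : ∀ n, #((P₁ ×ˢ P₃).filter (fun q => q.1 * q.2 = n)) ≤ 1 := by
    intro n
    refine Finset.card_le_one.mpr fun a ha b hb => ?_
    rw [Finset.mem_filter] at ha hb
    exact hinj ha.1 hb.1 (ha.2.trans hb.2.symm)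
  have hβb : ∀ n, |(#((P₁ ×ˢ P₃).filter (fun q => q.1 * q.2 = n)) : ℝ)| ≤ 1 := by
    intro n
    rw [abs_of_nonneg (Nat.cast_nonneg _)]
    exact_mod_cast hβle n
  have hwz : w ≤ (twinZ x : ℝ) := hw0z
  have hwy : w ≤ (twinY x : ℝ) := hwz.trans (by exact_mod_cast hzy)
  have hαs : ∀ n, (if n ∈ P₂ then (1 : ℝ) else 0) ≠ 0 → ∀ p ∈ n.primeFactors, w ≤ p := by
    intro n hn p hp
    split_ifs at hn with hmem
    · obtain ⟨hpr, hy, -, -⟩ := hP₂ n hmem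
      rw [hpr.primeFactors, Finset.mem_singleton] at hp
      subst hp
      exact hwy.trans (by exact_mod_cast hy)
    · exact absurd rfl hn
  have hβs : ∀ n, (#((P₁ ×ˢ P₃).filter (fun q => q.1 * q.2 = n)) : ℝ) ≠ 0 →
      ∀ p ∈ n.primeFactors, w ≤ p := by
    intro n hn p hp
    rw [Nat.cast_ne_zero] at hn
    obtain ⟨q, hq⟩ := Finset.card_ne_zero.mp hn
    rw [Finset.mem_filter] at hq
    obtain ⟨hqQ, hqn⟩ := hq
    obtain ⟨h1, h3, hz1, -, hy3, -, -⟩ := hQmem q hqQ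
    rw [← hqn, Nat.primeFactors_mul h1.ne_zero h3.ne_zero, h1.primeFactors, h3.primeFactors,
      Finset.mem_union, Finset.mem_singleton, Finset.mem_singleton] at hp
    rcases hp with rfl | rfl
    · exact hwz.trans (by exact_mod_cast hz1)
    · exact hwy.trans (by exact_mod_cast hy3)
  -- apply the brick on the box
  have hbox := brick_box_sum_le hx hε hw hK1 hK2 hW1 hW2 hW3 hW4 hαb hβb hαs hβs
    (h := -2) (Or.inr rfl)
  have heq : ∀ d : ℕ, ∑ t ∈ P₁ ×ˢ (P₂ ×ˢ P₃),
        (if d ∣ t.1 * t.2.1 * t.2.2 - 2 then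
          (ArithmeticFunction.liouville (t.1 * t.2.1 * t.2.2 - 2) : ℝ) else 0) =
      ∑ m ∈ Finset.Ioc M (2 * M), ∑ n ∈ (Finset.Ioc N (2 * N)).filter
          (fun n : ℕ => (d : ℤ) ∣ (m : ℤ) * n + (-2)),
        (if m ∈ P₂ then (1 : ℝ) else 0) * (#((P₁ ×ˢ P₃).filter (fun q => q.1 * q.2 = n)) : ℝ) *
          (ArithmeticFunction.liouville (Int.toNat ((m : ℤ) * n + (-2))) : ℝ) :=
    fun d => sum_product3_eq_box hS1 hS2 h2P₂ h1Q d
  simp_rw [heq]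
  exact hbox

end Summit.Parity.GeneralizedHardyLittlewood.Theorems
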